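import Summits.QuantumFields.YangMills.Theorems.BalabanUVNodesN15SiteCurvedColouredLayer
import HarnessLib

/-!
# Route «BalabanUVNodes», cluster K4 «SpineRates» — node N15 = NE2: THE SITE LAYER WITH THE BACKGROUND LIVE IN THE TwoGrid ENTRY CURRENCY, XXXIV — POSITIVE CONTROL FOR THE
# CURVED-DRESSED COLOURED SITE LAYER: the (3.35) window of part XXXIII's family is INHABITED by potentials at which the exact transporter species is NOT ZERO — a constant
# non-central skew-Hermitian potential `A′ ≡ rX₀` (every window `(c₃₅, α₀)`, every index) has `Ad(e^{η′A′}) ≠ 1`, i.e. the curved first-order coefficient `η′⁻¹(e^{η′ ad A′} − 1) ≠ 0`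

Cell `pub-ymgap`, WIDTH SEAT `pub-ymgap-dag-n15-w1` (generation 4; director-ym №197 ∕ HUMAN RULING D-0149; chair R455 (A) ∕ R461; dag-lead KEY MAP v2 INBOX l.35754; own CLAIM line on the
bus).  `bears_on: R4∕N15 · K3⁸ SpineGivenEndpointR13SepCoPHV (stmt-QuantumFields-27366; K3⁷ 20544 aside = lineage)`.  Filed `--kind proof --supports stmt-QuantumFields-27366 --as helper`
— COUNT-NEUTRAL.  THEOREMS ONLY (0 `def`, 0 `sorry`).  Imports BY NAME this seat's part XXXIII `…N15SiteCurvedColouredLayer` (`curvBgF`, `curvCube`; through it dag-n15-w3's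
`curvCoefA`∕`curvCoefA_inl`∕`expTrField`∕`expTrField_apply`, dag-n15-c 13a `norm_exp_sub_one_sub_self_le`, n15-b 16 `coordMat`∕`coordMat_sub`, this seat's part XXIV
`eq_zero_of_coordMat_eq_zero`? — no: re-derived here from `coordMat_sub`∕`coordMat_one` to keep the import light); nothing in the tree is modified.

WHY (the referees' A2∕A6 question for part XXXIII, answered in kernel as parts XIX §5 ∕ XXIV §6 ∕ XXVII §3 ∕ XXVIII §5 did for the first-order roads).  Part XXXIII's `NE2PlusSite`
quantifies over the potentials `A′` in the window `curvBgF.Reg335 c₃₅ α₀` (skew-Hermitian, three small-field letters at `c₃₅·(M_sz·α₀)`).  `A′ = 0` inhabits every window and there the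
dressing is trivial (`e^{0} = 1`, the species vanishes, `pr₀X̂ = G`).  THIS FILE shows the window also contains, for EVERY index and EVERY `c₃₅, α₀ > 0`, potentials at which the
dressing is GENUINE: the constant field `A′ ≡ rX₀` (`X₀` skew-Hermitian and NOT CENTRAL, `r = min (c₃₅M_szα₀) ¼ ∕ ‖X₀‖`) satisfies all four clauses (differences vanish), and its curved
first-order coefficient [Balaban1985BackgroundPropagators] (3.51)–(3.52) in transporter form, `a⁺_μ = η′⁻¹(S_μ − 1)` with `S = coordMat e (e^{η′ ad A′}) = Ad(e^{η′A′})` in coordinates,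
is NOT ZERO — because `e^{W} ≠ 1` for `0 < ‖W‖ ≤ ½` (second-order remainder `‖e^W − 1 − W‖ ≤ ‖W‖(e^{‖W‖} − 1) < ‖W‖`).  So part XXXIII's layer depends on the background exactly
where `M_N(ℂ)` is non-abelian; for `N = 1` (`ad ≡ 0`) it cannot, as it must.

CONTENTS.  §1 `exp_ne_one_of_norm_le_half` (complete normed algebra: `W ≠ 0`, `‖W‖ ≤ ½` ⟹ `e^W ≠ 1`); §2 `curvCoefA_inl_expTrField_ne_zero` (the curved forward coefficient of an
exponential transporter with generator `Z_μ(x) ≠ 0`, `‖ηZ_μ(x)‖ ≤ ½`, `η ≠ 0` is not zero); §3 ★ `exists_reg335_curvCoefA_ne_zero` (the window inhabitant with a non-zero species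
coefficient, every index of part XXXIII's family, every `c₃₅, α₀ > 0`, given ONE non-central skew-Hermitian matrix); §4 `exists_curvIndex_size_levels_ge` (the size
guard `M₅ ≤ gf.M` and the level count are COFINAL over the family — not the statement-level-vacuity trap).

HONEST FRAMING ∕ LIMITS.  Count-neutral; [folklore] (exponential remainder, injectivity of coordinates, a constant field); a NON-VACUITY certificate for part XXXIII's hypotheses, NOT an
estimate; it does not show that the dressed LAYER differs from `G′ ⊗ 1` as an operator (only that the species dressing it is non-zero), and says nothing about Bałaban's `G(U)` at the
datum's `U`.  Nothing of [B5]∕[B6]∕[B9] asserted ((3.35) p. 396, (3.50)–(3.52) p. 400 = SHAPES).  NE2⁺ NOT PRINTED ∕ NOT proved; **N15 is NOT discharged**; K3⁸ OPEN, not claimed,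
skeleton v6 untouched; counts of record UNMOVED (typed 28∕28 · discharged 5∕27, A 5∕28); one finite four-torus programme at fixed `ε` — NOT ℝ⁴, NOT infinite volume, NOT OS, NOT a mass
gap, NOT Clay; R4 closes the conditional finite-𝕋⁴ rung `BalabanLadder.UV` only.  Restate-immune (no Theses import).
-/

set_option autoImplicit false

noncomputable section
open scoped BigOperators Matrix Matrix.Norms.Frobenius

namespace Summit.QuantumFields.YangMills.BalabanUVNodes.N15.SiteLayerBg

open Real Finset NormedSpace
open Literature.MathematicalPhysics.QuantumFieldTheory.Balaban1983to89
open Literature.MathematicalPhysics.QuantumFieldTheory.Balaban1983to89.B5Prop11Plancherel (Tor fine unitVec)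
open Literature.MathematicalPhysics.QuantumFieldTheory.King1986.Torus (blockOf)
open Literature.MathematicalPhysics.QuantumFieldTheory.Balaban1983to89.Beta.AveragingCorrectionJets (adCLM adCLM_smul norm_adCLM_le)
open Literature.Barriers.QuantumFields (traceForm)
open Summit.QuantumFields.YangMills.BalabanUVNodes.N15.MatrixSpecies (coordMat coordMat_sub Phi0 norm_exp_sub_one_sub_self_le)
open Summit.QuantumFields.YangMills.BalabanUVNodes.N15.BackgroundLayer (coordMat_one coordMat_smul)
open Summit.QuantumFields.YangMills.BalabanUVNodes.N15.CurvedSpecies (torStep curvCoefA curvCoefA_inl expTrField expTrField_apply)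
open Summit.QuantumFields.YangMills.BalabanUVNodes.N15.VectorPiece (unitTorusGeoS)
open Summit.QuantumFields.YangMills.BalabanUVNodes.N15.MatrixSpecies (liftBlk)
open Summit.QuantumFields.YangMills.BalabanUVNodes.N15.BackgroundLayer (fineGeo)
open Summit.QuantumFields.YangMills.BalabanUVNodes.N15.OperatorReadout (opGeo)
open Summit.QuantumFields.YangMills.BalabanUVNodes.N15KingModelRung (KingVolIndex)

/-! ## §1 `e^W ≠ 1` for a small non-zero `W` -/

section Exp

variable {𝔸 : Type*} [NormedRing 𝔸] [NormedAlgebra ℝ 𝔸] [CompleteSpace 𝔸]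

/-- In a complete normed algebra, `W ≠ 0` and `‖W‖ ≤ ½` imply `e^W ≠ 1`: from `e^W = 1`, `‖W‖ = ‖e^W − 1 − W‖ ≤ ‖W‖·(e^{‖W‖} − 1)` and `e^{‖W‖} − 1 < 1` (`e^{1∕2} < 2`),
so `‖W‖ = 0`. [folklore] -/
theorem exp_ne_one_of_norm_le_half {W : 𝔸} (hW : W ≠ 0) (h : ‖W‖ ≤ 1 / 2) : exp W ≠ 1 := by
  intro heq
  have hpos : 0 < ‖W‖ := norm_pos_iff.mpr hW
  have h1 := norm_exp_sub_one_sub_self_le W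
  rw [heq, sub_self, zero_sub, norm_neg] at h1
  have hexp : Real.exp ‖W‖ < 2 := by
    have h2 : Real.exp ‖W‖ ≤ Real.exp (1 / 2) := Real.exp_le_exp.mpr h
    have h3 : Real.exp (1 / 2 : ℝ) < 1 / (1 - 1 / 2) := Real.exp_bound_div_one_sub_of_interval' (by norm_num) (by norm_num)
    have h4 : (1 : ℝ) / (1 - 1 / 2) = 2 := by norm_num
    linarith
  nlinarith

end Exp

/-! ## §2 The curved forward coefficient of an exponential transporter with a non-zero small generator is not zero -/

section Coef

variable {X ι J : Type} [Fintype ι] [DecidableEq ι] {𝔄 : Type} [NormedRing 𝔄] [NormedAlgebra ℝ 𝔄] [CompleteSpace 𝔄]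
  (e : 𝔄 ≃L[ℝ] (ι → ℝ)) (η : ℝ) (τ : J → X ≃ X) (R : J → X → Matrix ι ι ℝ) (Z : J → X → (𝔄 →L[ℝ] 𝔄))

/-- `curvCoefA η τ R (expTrField e η Z) (inl μ) x = η⁻¹·(coordMat e (e^{ηZ_μ(x)}) − 1) ≠ 0` when `Z_μ(x) ≠ 0`, `η ≠ 0`, `‖ηZ_μ(x)‖ ≤ ½` (coordinates are injective; §1).
[cite: Balaban1985BackgroundPropagators, (3.51)–(3.52) p.400 (the forward coefficient: shape)] -/
theorem curvCoefA_inl_expTrField_ne_zero {μ : J} {x : X} (hZ : Z μ x ≠ 0) (hη : η ≠ 0) (hsmall : ‖η • Z μ x‖ ≤ 1 / 2) :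
    curvCoefA η τ R (expTrField e η Z) (Sum.inl μ) x ≠ 0 := by
  rw [curvCoefA_inl, expTrField_apply]
  intro h0
  have h1 : coordMat e (Phi0 η (Z μ x)) - 1 = 0 := by
    rcases smul_eq_zero.mp h0 with h | h
    · exact absurd h (inv_ne_zero hη)
    · exact h
  have h2 : coordMat e (Phi0 η (Z μ x) - 1) = 0 := by rw [coordMat_sub, coordMat_one]; exact h1
  have h3 : Phi0 η (Z μ x) - 1 = 0 := by
    have h4 : ((((e : 𝔄 →L[ℝ] (ι → ℝ)).comp ((Phi0 η (Z μ x) - 1).comp (e.symm : (ι → ℝ) →L[ℝ] 𝔄))) : (ι → ℝ) →L[ℝ] (ι → ℝ)) : (ι → ℝ) →ₗ[ℝ] (ι → ℝ)) = 0 :=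
      LinearMap.toMatrix'.map_eq_zero_iff.1 h2
    ext v
    have h5 := LinearMap.congr_fun h4 (e v)
    simp only [ContinuousLinearMap.coe_coe, ContinuousLinearMap.coe_comp, Function.comp_apply, ContinuousLinearEquiv.coe_coe,
      ContinuousLinearEquiv.symm_apply_apply, LinearMap.zero_apply] at h5
    have h7 : (Phi0 η (Z μ x) - 1) v = 0 := e.injective (by rw [map_zero]; simpa using h5)
    simpa using h7
  have hW : η • Z μ x ≠ 0 := smul_ne_zero hη hZ
  exact exp_ne_one_of_norm_le_half hW hsmall (sub_eq_zero.mp h3)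

end Coef

/-! ## §3 ★ The window inhabitant of part XXXIII's family with a non-zero species coefficient -/

section Window

variable {d : ℕ} (L : ℕ) [NeZero L]
variable {n : Type} [Fintype n] [DecidableEq n] {κ : Type} [Fintype κ] [DecidableEq κ] (e : Matrix n n ℂ ≃L[ℝ] (κ → ℝ))

/-- ★ **POSITIVE CONTROL FOR PART XXXIII.**  Given ONE skew-Hermitian, NON-CENTRAL matrix `X₀` (`ad X₀ ≠ 0`; e.g. any non-scalar element of `𝔲(N)`, `N ≥ 2`), for EVERY index of
the curved family and EVERY `c₃₅, α₀ > 0` the constant potential `A′ ≡ rX₀`, `r = min (c₃₅M_szα₀) ¼ ∕ ‖X₀‖`, lies in the window `curvBgF.Reg335 c₃₅ α₀` (differences vanish) AND the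
curved forward coefficient of its exact transporter `e^{η′ ad A′} = Ad(e^{η′A′})` is NOT ZERO at every bond — the dressing of part XXXIII's layer is genuine there.
[cite: Balaban1985BackgroundPropagators, (3.35) p.396, (3.50)–(3.52) p.400 (shapes)] -/
theorem exists_reg335_curvCoefA_ne_zero (i : KingVolIndex d) {c35 α₀ : ℝ} (hc : 0 < c35) (hα : 0 < α₀) {X₀ : Matrix n n ℂ} (hX : X₀ᴴ = -X₀)
    (had : adCLM ℝ X₀ ≠ 0) (R : Fin (d + 1) → Tor (fine L (fine (L ^ i.K) (curvCube L i))) → Matrix κ κ ℝ) (μ : Fin (d + 1))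
    (x : Tor (fine L (fine (L ^ i.K) (curvCube L i)))) :
    ∃ A' : (curvBgF L n i).Cfg, (curvBgF L n i).Reg335 c35 α₀ A' ∧
      curvCoefA ((L : ℝ) ^ (i.K + 1))⁻¹ (torStep (fine L (fine (L ^ i.K) (curvCube L i)))) R
        (expTrField e ((L : ℝ) ^ (i.K + 1))⁻¹ (fun ν y' => adCLM ℝ (A' ν y'))) (Sum.inl μ) x ≠ 0 := by
  have hX0 : X₀ ≠ 0 := by rintro rfl; exact had (by ext Y; simp)
  have hXn : 0 < ‖X₀‖ := norm_pos_iff.mpr hX0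
  have hs : 0 < c35 * (i.Msz * α₀) := mul_pos hc (mul_pos (lt_of_lt_of_le one_pos i.one_le_Msz) hα)
  set r : ℝ := min (c35 * (i.Msz * α₀)) (1 / 4) / ‖X₀‖ with hrdef
  have hr : 0 < r := div_pos (lt_min hs (by norm_num)) hXn
  have hrX : r * ‖X₀‖ = min (c35 * (i.Msz * α₀)) (1 / 4) := by rw [hrdef]; field_simp
  have hL1 : (1 : ℝ) ≤ (L : ℝ) := by exact_mod_cast Nat.pos_of_ne_zero (NeZero.ne L)
  have hη : 0 < ((L : ℝ) ^ (i.K + 1))⁻¹ := by positivity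
  have hη1 : ((L : ℝ) ^ (i.K + 1))⁻¹ ≤ 1 := inv_le_one_of_one_le₀ (one_le_pow₀ hL1)
  refine ⟨fun _ _ => r • X₀, ⟨fun _ _ => ?_, fun _ _ => ?_, fun _ _ _ => ?_, fun _ _ _ => ?_⟩, ?_⟩
  · rw [Matrix.conjTranspose_smul, hX, star_trivial, smul_neg]
  · rw [norm_smul, Real.norm_eq_abs, abs_of_pos hr, hrX]
    exact min_le_left _ _
  · have h0 : (0 : ℝ) ≤ ((L : ℝ) ^ (i.K + 1))⁻¹ * (c35 * (i.Msz * α₀)) := by positivity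
    simpa using h0
  · have h0 : (0 : ℝ) ≤ ((L : ℝ) ^ (i.K + 1))⁻¹ * (c35 * (i.Msz * α₀)) := by positivity
    simpa using h0
  · have hZ : adCLM ℝ (r • X₀) ≠ 0 := by
      rw [adCLM_smul]
      exact smul_ne_zero hr.ne' had
    refine curvCoefA_inl_expTrField_ne_zero e _ _ R (fun ν y' => adCLM ℝ (r • X₀)) hZ hη.ne' ?_
    rw [norm_smul, Real.norm_eq_abs, abs_of_pos hη, adCLM_smul, norm_smul, Real.norm_eq_abs, abs_of_pos hr]
    have h1 : ‖adCLM ℝ X₀‖ ≤ 2 * ‖X₀‖ := norm_adCLM_le ℝ X₀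
    have h2 : r * ‖adCLM ℝ X₀‖ ≤ 2 * (1 / 4) := by
      calc r * ‖adCLM ℝ X₀‖ ≤ r * (2 * ‖X₀‖) := mul_le_mul_of_nonneg_left h1 hr.le
        _ = 2 * (r * ‖X₀‖) := by ring
        _ ≤ 2 * (1 / 4) := by rw [hrX]; exact mul_le_mul_of_nonneg_left (min_le_right _ _) (by norm_num)
    calc ((L : ℝ) ^ (i.K + 1))⁻¹ * (r * ‖adCLM ℝ X₀‖) ≤ 1 * (2 * (1 / 4)) := mul_le_mul hη1 h2 (by positivity) zero_le_one
      _ = 1 / 2 := by norm_num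

end Window


/-! ## §4 The size and level guards are live on the family -/

section Guards

variable {d : ℕ} (L : ℕ) [NeZero L] (κ : Type) [Fintype κ]

/-- **NOT THE STATEMENT-LEVEL-VACUITY TRAP**: the fine instance's [B9] size parameter `M_sz` AND the coarse instance's level count `K` are COFINAL over `KingVolIndex` — for every `R`
and `k` some index has `gf.M ≥ R` and `gc.k ≥ k` — so neither the guard `M₅ ≤ M` of `NE2PlusSite` nor a level bound voids part XXXIII's «+» block. [folklore] -/
theorem exists_curvIndex_size_levels_ge (R : ℝ) (k : ℕ) :
    ∃ i : KingVolIndex d,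
      R ≤ (fineGeo (unitTorusGeoS L i.K (curvCube L i) i.Msz) (Tor (fine L (fine (L ^ i.K) (curvCube L i))) × κ)
        (liftBlk (blockOf (L ^ i.K) (curvCube L i) ∘ blockOf L (fine (L ^ i.K) (curvCube L i))) κ) 1).M ∧
      k ≤ (opGeo (unitTorusGeoS L i.K (curvCube L i) i.Msz) (Tor (fine (L ^ i.K) (curvCube L i)) × κ) (liftBlk (blockOf (L ^ i.K) (curvCube L i)) κ)).k :=
  ⟨⟨0, max k 1, le_max_right _ _, max R 1, le_max_right _ _⟩, le_max_left _ _, le_max_left _ _⟩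

end Guards

end Summit.QuantumFields.YangMills.BalabanUVNodes.N15.SiteLayerBg

end
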